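import Literature.Geometry.DiscreteGeometry.TwoShellPatterns

/-!
# `NearFarGlueR` (stmt-AtomisticToContinuum-14970), negative side II: load-bearing hypotheses of the line `Sketch`

The picked line `Sketch` (prover-line-stmt-AtomisticToContinuum-14970-0, 2026-08-16) reduces the
crux to `ContactGapAt 3` through a descent lemma (`stub_descent`: from a good particle one steps to
a first-shell neighbour strictly closer to any particle farther than `3`) and a packing lemma
(`stub_fibre`: `#S ≤ (2R/δ+1)³·#T` if every particle of `S` is within `R` of `T`).  This file
records which of their hypotheses any proof must use:

* `not_good_of_lt_nineteen` — with fewer than `19` particles nobody is `ε`-good (the assignment is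
  injective on the `18`-point pattern and avoids the centre);
* `stub_descent_false_without_good` — `stub_descent` with the goodness of `i` dropped is false
  (two particles at distance `4`);
* `stub_fibre_false_without_sep` — `stub_fibre` with the separation hypothesis dropped is false
  (two coincident particles, `R = 0`, `δ = 1`).

Not load-bearing (paper, see the crux's `Disproof.lean`): the radius `3` of `stub_descent` and the
constant `1/4` of the covering stubs (the covering constant of both first shells is `√2/2`).
All `[folklore]`.
-/

noncomputable section

namespace Summit.AtomisticToContinuum.Crystallization.Theorems.NearFarGlueRNegative

open Literature.Geometry.DiscreteGeometry

/-- Fewer than `19` particles ⇒ nobody is good: a good particle has `18` distinct assigned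
neighbours other than itself. [folklore] -/
theorem not_good_of_lt_nineteen {ε lo hi : ℝ} {N : ℕ} (hN : N < 19) (x : Fin N → EuclideanSpace ℝ (Fin 3)) (i : Fin N) :
    ¬ IsTwoShellGood ε lo hi x i := by
  rintro ⟨a, -, -, A, P, f, hP, hf, hinj, -⟩
  classical
  have h18 : (P.image f).card = 18 := by
    rw [Finset.card_image_of_injOn hinj, card_eq_eighteen_of_twoShellPattern hP]
  have hsub : P.image f ⊆ Finset.univ.erase i := by
    intro k hk
    obtain ⟨v, hv, rfl⟩ := Finset.mem_image.1 hk
    exact Finset.mem_erase.2 ⟨(hf v hv).1, Finset.mem_univ _⟩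
  have hle := Finset.card_le_card hsub
  rw [h18, Finset.card_erase_of_mem (Finset.mem_univ i), Finset.card_univ, Fintype.card_fin] at hle
  omega

/-- **`stub_descent` needs the goodness of `i`.** With `IsTwoShellGood … x i` dropped the descent
statement is false: two (bad) particles `0` and `4·e₀` at distance `4 > 3`, and the only `k ≠ i` is
at distance `4 > 21/20`. [folklore] -/
theorem stub_descent_false_without_good :
    ¬ (∀ (N : ℕ) (x : Fin N → EuclideanSpace ℝ (Fin 3)) (i j : Fin N),
        ¬ IsTwoShellGood (1 / 20) (47 / 50) 1 x j → 3 < dist (x j) (x i) →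
          ∃ k : Fin N, k ≠ i ∧ dist (x k) (x i) ≤ 21 / 20 ∧ dist (x j) (x k) < dist (x j) (x i)) := by
  intro h
  have hd : dist ((![0, EuclideanSpace.single 0 4] : Fin 2 → EuclideanSpace ℝ (Fin 3)) 1)
      ((![0, EuclideanSpace.single 0 4] : Fin 2 → EuclideanSpace ℝ (Fin 3)) 0) = 4 := by
    simp
  obtain ⟨k, hk, hk', -⟩ := h 2 ![0, EuclideanSpace.single 0 4] 0 1
    (not_good_of_lt_nineteen (by norm_num) _ _) (by rw [hd]; norm_num)
  fin_cases k
  · exact hk rfl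
  · have : dist ((![0, EuclideanSpace.single 0 4] : Fin 2 → EuclideanSpace ℝ (Fin 3)) 1)
        ((![0, EuclideanSpace.single 0 4] : Fin 2 → EuclideanSpace ℝ (Fin 3)) 0) ≤ 21 / 20 := hk'
    rw [hd] at this
    norm_num at this

/-- **`stub_fibre` needs the separation hypothesis.** With `δ`-separation dropped the packing
bound is false: two coincident particles, `S = univ`, `T = {0}`, `R = 0`, `δ = 1` would give
`2 ≤ 1`. [folklore] -/
theorem stub_fibre_false_without_sep :
    ¬ (∀ (δ R : ℝ), 0 < δ → 0 ≤ R → ∀ (N : ℕ) (x : Fin N → EuclideanSpace ℝ (Fin 3)) (S T : Finset (Fin N)),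
        (∀ j ∈ S, ∃ k ∈ T, dist (x j) (x k) ≤ R) →
          (S.card : ℝ) ≤ (2 * R / δ + 1) ^ 3 * (T.card : ℝ)) := by
  intro h
  have := h 1 0 one_pos le_rfl 2 (fun _ => 0) Finset.univ {0}
    (fun j _ => ⟨0, Finset.mem_singleton_self 0, by simp⟩)
  simp at this

end Summit.AtomisticToContinuum.Crystallization.Theorems.NearFarGlueRNegative
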